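import Mathlib.FieldTheory.Galois.Abelian
import Mathlib.RingTheory.Norm.Transitivity
import Mathlib.GroupTheory.SpecificGroups.Cyclic
import HarnessLib

/-!
# Brick (b), local atom — V: GALOIS BOOKKEEPING OF A BICYCLIC EXTENSION `Gal(L/L₀) = ⟨σ⟩·⟨τ⟩` —
# the fixed field `M = L^τ`, the cyclic groups `Gal(L/M) = ⟨τ⟩`, `Gal(M/L₀) = ⟨σ̄⟩`, and the norm as a product of powers

Cell `bsd-print-cf2` (HOME `run/shared/lean/pub/bsd-print-cf2/`), width seat `bsd-line-cf2c-w5` g12, brick §4(b) (units side),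
deciding class crux stmt-BirchSwinnertonDyer-23300 (`m_line_pin_class`, stub `stub_localAtom` = the LOCAL ATOM of the f.g. half
of (U1)). THESES-FREE; theorems only (no `def`, no named fact, no `sorry`); Mathlib-only imports. This file is the Galois-theoretic
bookkeeping consumed by the assembled local bound (`…LeopoldtUnitsLocalBound.lean`), which feeds the two-step devissage
`LeopoldtAtV.exists_cover_of_devissage` (p744096) with `A := Lˣ`: for a finite Galois extension `L/L₀` whose group is generated
by two COMMUTING automorphisms `σ, τ` (every element is `σ^i τ^j`), with `M := L^{⟨τ⟩}` (`IntermediateField.fixedField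
(Subgroup.zpowers τ)`):

* `prod_range_pow_apply_eq_algebraMap_norm` — **the norm of a CYCLIC extension is the product over the powers of a generator**:
  `∏_{k < ord g} g^k x = N_{E/K}(x)` (`Algebra.norm_eq_prod_automorphisms` reindexed along `finEquivZPowers`) — this is how the
  devissage's `N₁ = Σ_{k<m₁} τ^k`, `N₀ = Σ_{k<m₀} σ^k` are read as `N_{L/M}`, `N_{M/L₀}`;
* `mem_fixedField_zpowers_iff` — `x ∈ L^{⟨τ⟩} ↔ τ x = x`; `normal_zpowers_of_forall_eq_zpow_mul_zpow` — `⟨τ⟩ ⊴ Gal` (the group is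
  abelian: `isAbelianGalois_of_forall_eq_zpow_mul_zpow`);
* `subgroupEquivAlgEquiv_apply_apply`, `forall_mem_zpowers_subgroupEquivAlgEquiv`, `isCyclic_gal_fixedField_zpowers`,
  `orderOf_subgroupEquivAlgEquiv` — `Gal(L/M)` is cyclic, generated by (the image `τ_M` of) `τ`, `ord τ_M = ord τ`;
* `restrictNormalHom_fixedField_zpowers_self` (`τ|_M = 1`), `forall_mem_zpowers_restrictNormalHom` (`Gal(M/L₀) = ⟨σ|_M⟩`),
  `isCyclic_gal_fixedField_zpowers_bot`;
* `isCyclic_of_forall_mem_zpowers` — a group with an element whose powers exhaust it is cyclic.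

HONEST FRAMING: textbook Galois theory (Mathlib's fundamental theorem `IntermediateField.subgroupEquivAlgEquiv`,
`IsGalois.of_fixedField_normal_subgroup`, `AlgEquiv.restrictNormalHom_surjective`); nothing here closes 23300; BSD is not proved
by any of this.

## References
* [SerreLocalFields1979] J.-P. Serre, *Local Fields*, GTM 67 (1979), Ch. X §1 (Hilbert 90 set-up: cyclic `G = ⟨s⟩`, `N = Σ s^i`).
* [NeukirchANT1999] J. Neukirch, *Algebraic Number Theory* (1999), Ch. IV §1 (Galois bookkeeping of towers).
-/

set_option linter.dupNamespace false -- D-0017: single-problem summit, `…BirchSwinnertonDyer.BirchSwinnertonDyer…` repeats a namespace by design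
set_option autoImplicit false

open IntermediateField

namespace Summit.BirchSwinnertonDyer.BirchSwinnertonDyer.Theorems.PrintCf2.LeopoldtAtV

/-! ### §1. Cyclic groups from a generator; the norm of a cyclic extension as a product of powers -/

/-- A group with an element `g` whose integer powers exhaust it is cyclic. [folklore] -/
theorem isCyclic_of_forall_mem_zpowers {G : Type*} [Group G] (g : G) (hg : ∀ x, x ∈ Subgroup.zpowers g) : IsCyclic G :=
  ⟨⟨g, fun x ↦ by simpa [Subgroup.mem_zpowers_iff] using hg x⟩⟩

/-- ★ **The norm of a cyclic extension is the product over the powers of a generator**: for a finite Galois extension `E/K`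
whose group is generated by `g` (of order `m`), `∏_{k<m} g^k x = N_{E/K}(x)` in `E` (Mathlib's `Algebra.norm_eq_prod_automorphisms`,
reindexed by `k ↦ g^k`, `finEquivZPowers`). [cite: SerreLocalFields1979, Ch. X §1] -/
theorem prod_range_pow_apply_eq_algebraMap_norm {K E : Type*} [Field K] [Field E] [Algebra K E] [FiniteDimensional K E]
    [IsGalois K E] (g : E ≃ₐ[K] E) (hg : ∀ f : E ≃ₐ[K] E, f ∈ Subgroup.zpowers g) (x : E) :
    ∏ k ∈ Finset.range (orderOf g), (g ^ k) x = algebraMap K E (Algebra.norm K x) := by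
  rw [Algebra.norm_eq_prod_automorphisms, ← Fin.prod_univ_eq_prod_range (fun k ↦ (g ^ k) x) (orderOf g)]
  have hfin : IsOfFinOrder g := isOfFinOrder_of_finite g
  let e : Fin (orderOf g) ≃ (E ≃ₐ[K] E) := (finEquivZPowers hfin).trans (Equiv.subtypeUnivEquiv hg)
  exact Fintype.prod_equiv e _ _ fun k ↦ by simp [e, finEquivZPowers_apply]

/-- The norm of a cyclic extension is `1` iff the product over the powers of a generator is `1`. [cite: SerreLocalFields1979, Ch. X §1] -/
theorem norm_eq_one_iff_prod_range_pow_apply_eq_one {K E : Type*} [Field K] [Field E] [Algebra K E] [FiniteDimensional K E]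
    [IsGalois K E] (g : E ≃ₐ[K] E) (hg : ∀ f : E ≃ₐ[K] E, f ∈ Subgroup.zpowers g) (x : E) :
    Algebra.norm K x = 1 ↔ ∏ k ∈ Finset.range (orderOf g), (g ^ k) x = 1 := by
  rw [prod_range_pow_apply_eq_algebraMap_norm g hg x, ← (algebraMap K E).map_one]
  exact ⟨fun h ↦ by rw [h], fun h ↦ (algebraMap K E).injective h⟩

/-! ### §2. A Galois group generated by two commuting automorphisms -/

section Bicyclic

variable {L₀ L : Type*} [Field L₀] [Field L] [Algebra L₀ L]

/-- Two commuting elements `σ, τ` with every group element of the form `σ^i τ^j`: any two elements commute. [folklore] -/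
theorem commute_of_forall_eq_zpow_mul_zpow {G : Type*} [Group G] {σ τ : G} (hστ : σ * τ = τ * σ)
    (hgen : ∀ g : G, ∃ i j : ℤ, g = σ ^ i * τ ^ j) (g h : G) : Commute g h := by
  have hc : Commute σ τ := hστ
  obtain ⟨i, j, rfl⟩ := hgen g
  obtain ⟨k, l, rfl⟩ := hgen h
  refine Commute.mul_left (Commute.mul_right ((Commute.refl σ).zpow_zpow i k) (hc.zpow_zpow i l))
    (Commute.mul_right (hc.symm.zpow_zpow j k) ((Commute.refl τ).zpow_zpow j l))

/-- If `Gal(L/L₀)` is generated by two commuting automorphisms, `L/L₀` (Galois) is ABELIAN. [folklore] -/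
theorem isAbelianGalois_of_forall_eq_zpow_mul_zpow [IsGalois L₀ L] {σ τ : L ≃ₐ[L₀] L} (hστ : σ * τ = τ * σ)
    (hgen : ∀ g : L ≃ₐ[L₀] L, ∃ i j : ℤ, g = σ ^ i * τ ^ j) : IsAbelianGalois L₀ L :=
  letI : IsMulCommutative (L ≃ₐ[L₀] L) := ⟨⟨fun g h ↦ (commute_of_forall_eq_zpow_mul_zpow hστ hgen g h).eq⟩⟩
  {}

/-- `⟨τ⟩` is a normal subgroup when the group is generated by two commuting elements `σ, τ`. [folklore] -/
theorem normal_zpowers_of_forall_eq_zpow_mul_zpow {G : Type*} [Group G] {σ τ : G} (hστ : σ * τ = τ * σ)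
    (hgen : ∀ g : G, ∃ i j : ℤ, g = σ ^ i * τ ^ j) : (Subgroup.zpowers τ).Normal :=
  ⟨fun n hn g ↦ by rwa [(commute_of_forall_eq_zpow_mul_zpow hστ hgen g n).eq, mul_inv_cancel_right]⟩

/-- **`x ∈ L^{⟨τ⟩} ↔ τ x = x`** (the fixed field of the cyclic group `⟨τ⟩`). [folklore] -/
theorem mem_fixedField_zpowers_iff (τ : L ≃ₐ[L₀] L) (x : L) :
    x ∈ fixedField (Subgroup.zpowers τ) ↔ τ x = x := by
  rw [mem_fixedField_iff]
  refine ⟨fun h ↦ h τ (Subgroup.mem_zpowers τ), fun h f hf ↦ ?_⟩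
  obtain ⟨k, rfl⟩ := Subgroup.mem_zpowers_iff.1 hf
  have key : ∀ n : ℕ, (τ ^ n) x = x := fun n ↦ by
    induction n with
    | zero => rfl
    | succ n ih => rw [pow_succ, AlgEquiv.mul_apply, h, ih]
  rcases Int.eq_nat_or_neg k with ⟨n, rfl | rfl⟩
  · rw [zpow_natCast, key]
  · rw [zpow_neg, zpow_natCast, AlgEquiv.aut_inv, AlgEquiv.symm_apply_eq]
    exact (key n).symm

/-- An automorphism commuting with `τ` preserves `L^{⟨τ⟩}`. [folklore] -/
theorem apply_mem_fixedField_zpowers {σ τ : L ≃ₐ[L₀] L} (hστ : σ * τ = τ * σ) {x : L}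
    (hx : x ∈ fixedField (Subgroup.zpowers τ)) : σ x ∈ fixedField (Subgroup.zpowers τ) := by
  rw [mem_fixedField_zpowers_iff] at hx ⊢
  have := congrArg (fun f : L ≃ₐ[L₀] L ↦ f x) hστ
  simp only [AlgEquiv.mul_apply, hx] at this
  exact this.symm

/-- The isomorphism `H ≃* Gal(L/L^H)` of the fundamental theorem acts on `L` as the underlying automorphism. [folklore] -/
theorem subgroupEquivAlgEquiv_apply_apply [FiniteDimensional L₀ L] (H : Subgroup (L ≃ₐ[L₀] L)) (h : H) (x : L) :
    subgroupEquivAlgEquiv H h x = (h : L ≃ₐ[L₀] L) x := rfl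

/-- **`Gal(L/L^{⟨τ⟩})` is generated by `τ`** (read through `subgroupEquivAlgEquiv`): every `L^{⟨τ⟩}`-automorphism of `L` is an
integer power of `τ_M := subgroupEquivAlgEquiv ⟨τ⟩ τ`. [folklore] -/
theorem forall_mem_zpowers_subgroupEquivAlgEquiv [FiniteDimensional L₀ L] (τ : L ≃ₐ[L₀] L)
    (f : L ≃ₐ[fixedField (Subgroup.zpowers τ)] L) :
    f ∈ Subgroup.zpowers (subgroupEquivAlgEquiv (Subgroup.zpowers τ) ⟨τ, Subgroup.mem_zpowers τ⟩) := by
  obtain ⟨h, rfl⟩ := (subgroupEquivAlgEquiv (Subgroup.zpowers τ)).surjective f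
  obtain ⟨k, hk⟩ := Subgroup.mem_zpowers_iff.1 h.2
  refine Subgroup.mem_zpowers_iff.2 ⟨k, ?_⟩
  rw [← map_zpow]
  congr 1
  ext1
  simp [hk]

/-- `Gal(L/L^{⟨τ⟩})` is cyclic. [folklore] -/
theorem isCyclic_gal_fixedField_zpowers [FiniteDimensional L₀ L] (τ : L ≃ₐ[L₀] L) :
    IsCyclic (L ≃ₐ[fixedField (Subgroup.zpowers τ)] L) :=
  isCyclic_of_forall_mem_zpowers _ (forall_mem_zpowers_subgroupEquivAlgEquiv τ)

/-- The generator `τ_M` of `Gal(L/L^{⟨τ⟩})` has the order of `τ`. [folklore] -/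
theorem orderOf_subgroupEquivAlgEquiv [FiniteDimensional L₀ L] (τ : L ≃ₐ[L₀] L) :
    orderOf (subgroupEquivAlgEquiv (Subgroup.zpowers τ) ⟨τ, Subgroup.mem_zpowers τ⟩) = orderOf τ := by
  rw [MulEquiv.orderOf_eq, ← Subgroup.orderOf_coe]

/-- **`∏_{k < ord τ} τ^k x = N_{L/L^{⟨τ⟩}}(x)`**: the devissage's `N₁ = Σ_{k<m₁} τ^k` (written multiplicatively) is the norm to the
fixed field of `τ`. [cite: SerreLocalFields1979, Ch. X §1] -/
theorem prod_range_pow_apply_eq_algebraMap_norm_fixedField [FiniteDimensional L₀ L] [IsGalois L₀ L] (τ : L ≃ₐ[L₀] L) (x : L) :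
    ∏ k ∈ Finset.range (orderOf τ), (τ ^ k) x =
      algebraMap (fixedField (Subgroup.zpowers τ)) L (Algebra.norm (fixedField (Subgroup.zpowers τ)) x) := by
  rw [← prod_range_pow_apply_eq_algebraMap_norm _ (forall_mem_zpowers_subgroupEquivAlgEquiv τ) x,
    orderOf_subgroupEquivAlgEquiv]
  refine Finset.prod_congr rfl fun k _ ↦ ?_
  rw [← map_pow, subgroupEquivAlgEquiv_apply_apply, SubmonoidClass.coe_pow]

/-- `τ` restricts to the identity of `L^{⟨τ⟩}`. [folklore] -/
theorem restrictNormalHom_fixedField_zpowers_self (τ : L ≃ₐ[L₀] L) [Normal L₀ (fixedField (Subgroup.zpowers τ))] :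
    AlgEquiv.restrictNormalHom (fixedField (Subgroup.zpowers τ)) τ = 1 := by
  change τ.restrictNormal _ = 1
  rw [AlgEquiv.restrictNormal_eq_one_iff]
  intro x hx
  exact (mem_fixedField_zpowers_iff τ x).1 hx

/-- **`Gal(L^{⟨τ⟩}/L₀)` is generated by the restriction `σ̄` of `σ`** when `Gal(L/L₀) = {σ^i τ^j}`. [folklore] -/
theorem forall_mem_zpowers_restrictNormalHom [Normal L₀ L] {σ τ : L ≃ₐ[L₀] L}
    (hgen : ∀ g : L ≃ₐ[L₀] L, ∃ i j : ℤ, g = σ ^ i * τ ^ j) [Normal L₀ (fixedField (Subgroup.zpowers τ))]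
    (f : fixedField (Subgroup.zpowers τ) ≃ₐ[L₀] fixedField (Subgroup.zpowers τ)) :
    f ∈ Subgroup.zpowers (AlgEquiv.restrictNormalHom (fixedField (Subgroup.zpowers τ)) σ) := by
  obtain ⟨g, rfl⟩ := AlgEquiv.restrictNormalHom_surjective L f
  obtain ⟨i, j, rfl⟩ := hgen g
  rw [map_mul, map_zpow, map_zpow, restrictNormalHom_fixedField_zpowers_self, one_zpow, mul_one]
  exact Subgroup.zpow_mem_zpowers _ _

/-- `Gal(L^{⟨τ⟩}/L₀)` is cyclic when `Gal(L/L₀) = {σ^i τ^j}`. [folklore] -/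
theorem isCyclic_gal_fixedField_zpowers_bot [Normal L₀ L] {σ τ : L ≃ₐ[L₀] L}
    (hgen : ∀ g : L ≃ₐ[L₀] L, ∃ i j : ℤ, g = σ ^ i * τ ^ j) [Normal L₀ (fixedField (Subgroup.zpowers τ))] :
    IsCyclic (fixedField (Subgroup.zpowers τ) ≃ₐ[L₀] fixedField (Subgroup.zpowers τ)) :=
  isCyclic_of_forall_mem_zpowers _ (forall_mem_zpowers_restrictNormalHom hgen)

/-- **`∏_{k < ord σ̄} σ^k y = N_{L^{⟨τ⟩}/L₀}(y)`** for `y ∈ L^{⟨τ⟩}`, `σ̄ = σ|_{L^{⟨τ⟩}}`: the devissage's `N₀ = Σ_{k<m₀} σ^k` on the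
`τ`-fixed points is the norm `L^{⟨τ⟩} → L₀`. [cite: SerreLocalFields1979, Ch. X §1] -/
theorem prod_range_pow_apply_eq_algebraMap_norm_bot [Normal L₀ L] {σ τ : L ≃ₐ[L₀] L}
    (hgen : ∀ g : L ≃ₐ[L₀] L, ∃ i j : ℤ, g = σ ^ i * τ ^ j)
    [FiniteDimensional L₀ (fixedField (Subgroup.zpowers τ))] [IsGalois L₀ (fixedField (Subgroup.zpowers τ))]
    (y : fixedField (Subgroup.zpowers τ)) :
    ∏ k ∈ Finset.range (orderOf (AlgEquiv.restrictNormalHom (fixedField (Subgroup.zpowers τ)) σ)), (σ ^ k) (y : L) =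
      algebraMap L₀ L (Algebra.norm L₀ y) := by
  rw [IsScalarTower.algebraMap_apply L₀ (fixedField (Subgroup.zpowers τ)) L,
    ← prod_range_pow_apply_eq_algebraMap_norm _ (forall_mem_zpowers_restrictNormalHom hgen) y, map_prod]
  refine Finset.prod_congr rfl fun k _ ↦ ?_
  rw [← map_pow, IntermediateField.algebraMap_apply, AlgEquiv.restrictNormalHom_apply]

/-- A power of `σ` of exponent the order of `σ̄ = σ|_{L^{⟨τ⟩}}` fixes `L^{⟨τ⟩}` pointwise (hypothesis `hσ` of the devissage).
[folklore] -/
theorem pow_orderOf_restrictNormalHom_apply [Normal L₀ L] (σ τ : L ≃ₐ[L₀] L) [Normal L₀ (fixedField (Subgroup.zpowers τ))]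
    {x : L} (hx : τ x = x) :
    (σ ^ orderOf (AlgEquiv.restrictNormalHom (fixedField (Subgroup.zpowers τ)) σ)) x = x := by
  have hxM : x ∈ fixedField (Subgroup.zpowers τ) := (mem_fixedField_zpowers_iff τ x).2 hx
  set m := orderOf (AlgEquiv.restrictNormalHom (fixedField (Subgroup.zpowers τ)) σ)
  have h1 : AlgEquiv.restrictNormalHom (fixedField (Subgroup.zpowers τ)) (σ ^ m) = 1 := by
    rw [map_pow]; exact pow_orderOf_eq_one _
  have h2 := AlgEquiv.restrictNormalHom_apply (fixedField (Subgroup.zpowers τ)) (σ ^ m) ⟨x, hxM⟩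
  rw [h1, AlgEquiv.one_apply] at h2
  exact h2.symm

end Bicyclic

end Summit.BirchSwinnertonDyer.BirchSwinnertonDyer.Theorems.PrintCf2.LeopoldtAtV
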